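import Summits.QuantumFields.BalabanUV.T4Continuum.Support.NE7ApeCurvedRepRoadBScalarFreeEnd
import Summits.QuantumFields.BalabanUV.T4Continuum.Support.NE7ConstrainedGreenSymmetricMass
import Summits.QuantumFields.BalabanUV.T4Continuum.Support.NE7BalabanSliceSourceDuality
import Summits.QuantumFields.BalabanUV.T4Continuum.Support.NE7TensionRadiusOfFluxGradient
import HarnessLib
import Summits.QuantumFields.BalabanUV.T4Continuum.Support.NE7ApeCurvedRepRoadBPositivityMassEnd
import Summits.QuantumFields.BalabanUV.T4Continuum.Support.NE7LandauCorrection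
import Summits.QuantumFields.BalabanUV.T4Continuum.Support.NE7ApeCurvedRepRoadBSlicePoincareEnd
import Summits.QuantumFields.BalabanUV.T4Continuum.Support.NE7SlicePoincareTA
import Summits.QuantumFields.BalabanUV.T4Continuum.Support.NE7ApeCurvedRepRoadBFrameFreeEnd
import Summits.QuantumFields.BalabanUV.T4Continuum.Support.NE7SlicePoincareTAClass
import Summits.QuantumFields.BalabanUV.T4Continuum.Support.NE7ApeCurvedRepRoadBClassEnd
import Summits.QuantumFields.BalabanUV.T4Continuum.Support.NE7QbarAdjointSupRow
import Summits.QuantumFields.BalabanUV.T4Continuum.Support.NE7ConstrainedGreenRowsSplit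
import Summits.QuantumFields.BalabanUV.T4Continuum.Support.NE7QbarSupRow

/-!
# NE7ApeCurvedRepRoadBSplitRowsEnd — THE CURVED (APE) ON THE CLASS WITH ITS LAST ANALYTIC LETTERS IN PRINT's OWN SHAPE: F227 `smallField_of_tanCritical_roadB_class_end` with the rows (C) of the
# constrained propagator `C_a(W) = G_a − G_aQ̄†(Q̄G_aQ̄†)⁻¹Q̄G_a` SPLIT (F200) into the sup-VALUE row `A₀` and sup-CURL row `A₁` of `G_a(W) = Δ_a(W)⁻¹` ([B9] Thm 3.3 (3.42)₁,₂ SHAPE) and the sup row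
# `A_E` of `(Q̄G_aQ̄†)⁻¹` ((3.49) SHAPE), the two `ℓ^∞` letters DISCHARGED — `c_Q = 2M` (F205) and `c_Q* = 2·card n·M^{1−d}` (F229) — so `K₀ = A₀(1 + c_Q*A_E c_Q A₀)`, `K = A₁(1 + c_Q*A_E c_Q A₀)`
# (file 160 of the curved (APE), F230)

Cell `pub-balaban`, rung (B)+1 sub-cell t4, lineage `b2b-balaban-t4-ne7-p1` (CRUX PROVER NE7 #1 = OWNER of row NE7), generation 86; memo
`t4/b2b-balaban-t4-ne7-p1-g86/ORBIT-COMPARISON.md` §6.  Over F227 (END on the class), F200 `NE7ConstrainedGreenRowsSplit` (rows of `C` from rows of `G`, `Dinv`, `c_Q`, `c_Q*`), F205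
`NE7QbarSupRow.qbarOpK_supRow`, F229 `NE7QbarAdjointSupRow.adjoint_qbarOpK_supRow_class` and F202's named inverses `softSymGreenKa`, `softSymDinvKa`, `cGreenSymKa = constrainedGreen …` BY NAME.
WHAT ([folklore]; 0 def, 0 sorry).  §1 `valueRow_of_split`, `curlRow_of_split` (the END's rows (C) from print's three rows + the column line); §2 **`smallField_of_tanCritical_roadB_splitRows_end`**:
F227 with `hC0 hC1` REPLACED by the named operators `Gop = softSymGreenKa …`, `Dop = softSymDinvKa …`, their rows `hG0 hG1 hE`, the column line `hcol : d·L^{d−1}·Ssum ≤ 1∕2`, and the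
defining equations `hK0def`, `hKdef` of the END's constants.
HONEST FRAMING (page 1): the DISPLAYED analytic letters of the curved (APE) are now exactly print's [B9] Thm 3.3 (3.42)₁,₂ rows for `G_a(W)` and (3.49) row for `(Q̄G_aQ̄†)⁻¹` at a curved class
background for OUR concrete operators (NE9 ∕ lit-balaban, the wall (ε)), plus the bootstrap line and k-free numeric lines; NOT proved here; (APE) on curved data NOT proved unconditionally;
NOT ONE-STEP, NOT NE7; spine 0∕9; finite T⁴ rung (B)+1 — NOT infinite volume, NOT mass gap, NOT `BetaPertH`, NOT Clay.  Continuum YM on T⁴ ⇐ BetaPertH ∧ nine spine estimates (0/9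
proved); BetaPertH ⇐ (D1) ∧ (D4) ∧ CAP+tail; G-an2-4 gates asym, D1 and NE2/3/4.
-/

set_option autoImplicit false

open scoped BigOperators InnerProductSpace Matrix Matrix.Norms.L2Operator
open NormedSpace Finset

namespace Summit.QuantumFields.BalabanUV.T4Continuum.NE7ApeCurvedRepRoadBSplitRowsEnd

open Literature.MathematicalPhysics.QuantumFieldTheory.Balaban1983to89
open B7Prop1Explicit B7Prop2Explicit MatrixLog UnitaryModel
open T4AveragingDeficitWall (Ad IsUnitaryCfg IsSkewDir SmallField vary curlAt dirL1 flux covGrad)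
open T4AveragingDeficitWallBoundary (IsPeriodicCfg periodBox)
open AveragingDeficitPeriodicCounting (IsPeriodicDir)
open AveragingDeficitTwoLevelPrep (twoLevelSmall)
open AveragingDeficitMultiLevelPrep (cavgIter LevelSmall)
open MinimalActionLevels (perWin)
open BlockAverageVaryHolo (nbRad)
open BlockAveragePushDirGauge (gaugeDir)
open NE3HessForm (hess dAction)
open NE3TangentCovariantTower (dirIter QbarIter)
open NE3EnergyShapes (IsUnitarySite IsPeriodicSite)
open NE3CovariantWeitzenbock (covDiv)
open NE3RightInverseSupLetters (frameC supC corrC)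
open NE3QbarIterCovLiftPrep (cruxC)
open NE3RightInverseSolveLetters (thetaLoc)
open NE3HatInvCurlLetters (curl1C)
open BlockAverageVaryDisc (rho0)
open NE3LinearisedAverageSup (curvSum)
open NE3HilbertSchmidtTorus (Form extF)
open NE3.PairLandauB8 (IsLandauB8)
open NE7ApeCurvedRepRoadBScalarFreeEnd (smallField_of_tanCritical_roadB_scalarFree_end)
open NE7BalabanSliceSourceDuality (balabanSliceLetter_of_sourceLetter)
open NE7ConstrainedGreenIdentity (constrainedGreen)
open NE7BalabanSoftOperator (skewForms qbarOpK)
open NE3QbarIterCovLiftPrep (cruxC)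
open NE7BalabanSoftOperatorMass (softSymOpKa cGreenSymKa)
open NE7BalabanSoftOperator (skewSecs gradOpK landauProjK)
open NE3RightInverseSolveLetters (thetaLoc)
open NE3QbarIterCovLiftPrep (liftC)
open AveragingDeficitTwoLevelPrep (prop1Radius)
open SpreadLift (loopRad)
open T4AveragingDeficitWall (dirSq curlSq)
open NE3HilbertSchmidtTorus (Form extF)
open NE7LandauCorrection (softSymOpKa_posDef_of_slicePoincare)
open NE7ApeCurvedRepRoadBPositivityMassEnd (smallField_of_tanCritical_roadB_positivityMass_end)
open NE7ApeCurvedRepRoadBSlicePoincareEnd (smallField_of_tanCritical_roadB_slicePoincare_end)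
open NE7SlicePoincareTA (slicePoincare_TA_of_frameFree)
open NE7ApeCurvedRepRoadBClassEnd (regTA_class smallField_of_tanCritical_roadB_class_end)
open NE7BalabanSoftOperatorMass (softSymGreenKa softSymDinvKa)
open NE7ConstrainedGreenRowsSplit (valueRow_constrainedGreen curlRow_constrainedGreen)
open NE7QbarSupRow (qbarOpK_supRow)
open NE7QbarAdjointSupRow (adjoint_qbarOpK_supRow_class)
open NE3CovariantLineSumsError (Ssum)
open NE7ApeCurvedRepRoadBFrameFreeEnd (CT_nonneg H1_of_frameFree smallField_of_tanCritical_roadB_frameFree_end)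
open NE7SlicePoincareTAClass (cdivSq_le)
open NE3ClassRadiusFamily (classSlicePoincare_of_lines' CPLine_nonneg)
open NE3SlicePoincareBudgetLine (ShLine SmallYLine CPLine)
open NE3CovariantLineSumsL2 (C2sq)
open NE3CovariantLineSumsL2Tower (rho)
open MinimalActionRate (sfClass)
open NE3FrameFreeSliceW (frameFreeBlockLandauW)
open NE3SlicePoincareShape (SlicePoincare)
open NE7SquaredBumpNestedMeanOperator (tentMean2)
open NE7ConstrainedGreenSymmetricMass (sourceLetter_of_posDef_rowsA)
open NE7TensionRadiusOfFluxGradient (abs_dAction_le_of_fluxGrad)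

noncomputable section

variable {d : ℕ} {n : Type*} [Fintype n] [DecidableEq n]

/-! ## §1 The END's rows (C) from print's rows -/

section Split

variable [Nonempty n] {L N : ℕ} [NeZero N] (hL : 2 ≤ L) (j : ℕ) [NeZero (N * L ^ (j + 1))]
  {W : Site d → Fin d → (Matrix n n ℂ)ˣ} {x : ℝ} (hWu : IsUnitaryCfg W) (hWP : IsPeriodicCfg W ((N * L ^ (j + 1) : ℕ) : ℤ))
  (hx : 0 ≤ x) (hs : LevelSmall d L j x) (hWx : SmallField W x) (hθx : cruxC d L * (((L : ℝ) ^ (j + 1)) ^ 2 * x) < 1) (a : ℝ)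
  {hpos : ∀ b : skewForms d n (N * L ^ (j + 1)), b ≠ 0 → 0 < ⟪b, softSymOpKa (N := N) (one_le_two.trans hL) j hWu hx hs hWx a b⟫_ℝ}
  {C : skewForms d n (N * L ^ (j + 1)) →ₗ[ℝ] skewForms d n (N * L ^ (j + 1))}
  (hCdef : C = cGreenSymKa (N := N) (one_le_two.trans hL) j hWu hx hs hWx hWP hL hθx a hpos)
  {Gop : skewForms d n (N * L ^ (j + 1)) →ₗ[ℝ] skewForms d n (N * L ^ (j + 1))}
  (hGdef : Gop = softSymGreenKa (N := N) (one_le_two.trans hL) j hWu hx hs hWx a hpos)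
  {Dop : skewForms d n N →ₗ[ℝ] skewForms d n N}
  (hDdef : Dop = softSymDinvKa (N := N) (one_le_two.trans hL) j hWu hx hs hWx hWP hL hθx a hpos)
  {A₀ A₁ AE : ℝ}
  (hG0 : ∀ h : skewForms d n (N * L ^ (j + 1)), ∀ g : ℝ, (∀ (y : Site d) (κ : Fin d), ‖extF (N * L ^ (j + 1)) (h : Form d n (N * L ^ (j + 1))) y κ‖ ≤ g) →
    ∀ (y : Site d) (κ : Fin d), ‖extF (N * L ^ (j + 1)) ((Gop h : skewForms d n (N * L ^ (j + 1))) : Form d n (N * L ^ (j + 1))) y κ‖ ≤ A₀ * g)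

include hCdef hGdef hDdef hG0 in
/-- **THE VALUE ROW OF `C_a(W)` FROM PRINT's ROWS** (`K₀ = A₀ + A₀·c_Q*·A_E·c_Q·A₀`, `c_Q = 2M`, `c_Q* = 2·card n·((L^d)⁻¹L)^{j+1}`). [folklore] -/
theorem valueRow_of_split
    (hE : ∀ f : skewForms d n N, ∀ g : ℝ, (∀ (y : Site d) (κ : Fin d), ‖extF N (f : Form d n N) y κ‖ ≤ g) →
      ∀ (y : Site d) (κ : Fin d), ‖extF N ((Dop f : skewForms d n N) : Form d n N) y κ‖ ≤ AE * g)
    (hcol : d * (L : ℝ) ^ (d - 1) * Ssum d L (j + 1) x ≤ 1 / 2) {K₀ : ℝ}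
    (hK0def : K₀ = A₀ + A₀ * (2 * (Fintype.card n : ℝ) * (((L : ℝ) ^ d)⁻¹ * L) ^ (j + 1)) * AE * (2 * (L : ℝ) ^ (j + 1)) * A₀) :
    ∀ h : skewForms d n (N * L ^ (j + 1)), ∀ g : ℝ, (∀ (y : Site d) (κ : Fin d), ‖extF (N * L ^ (j + 1)) (h : Form d n (N * L ^ (j + 1))) y κ‖ ≤ g) →
      ∀ (y : Site d) (κ : Fin d), ‖extF (N * L ^ (j + 1)) ((C h : skewForms d n (N * L ^ (j + 1))) : Form d n (N * L ^ (j + 1))) y κ‖ ≤ K₀ * g := by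
  intro h g hh y κ
  subst hGdef hDdef
  rw [hK0def, hCdef]
  exact valueRow_constrainedGreen _ _ _ _ hG0
    (fun b g' hb y' κ' => qbarOpK_supRow (N := N) (one_le_two.trans hL) hL j hWu hWP hx hs hWx b g' hb y' κ')
    (fun m' g' hm y' κ' => adjoint_qbarOpK_supRow_class (N := N) (one_le_two.trans hL) j hWu hWP hx hs hWx hcol m' g' hm y' κ') hE h hh y κ

include hCdef hGdef hDdef hG0 in
/-- **THE CURL ROW OF `C_a(W)` FROM PRINT's ROWS** (`K = A₁ + A₁·c_Q*·A_E·c_Q·A₀`). [folklore] -/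
theorem curlRow_of_split
    (hG1 : ∀ h : skewForms d n (N * L ^ (j + 1)), ∀ g : ℝ, (∀ (y : Site d) (κ : Fin d), ‖extF (N * L ^ (j + 1)) (h : Form d n (N * L ^ (j + 1))) y κ‖ ≤ g) →
      ∀ (z : Site d) (μ' ν' : Fin d), μ' ≠ ν' → ‖curlAt W (extF (N * L ^ (j + 1)) ((Gop h : skewForms d n (N * L ^ (j + 1))) : Form d n (N * L ^ (j + 1)))) z μ' ν'‖ ≤ A₁ * g)
    (hE : ∀ f : skewForms d n N, ∀ g : ℝ, (∀ (y : Site d) (κ : Fin d), ‖extF N (f : Form d n N) y κ‖ ≤ g) →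
      ∀ (y : Site d) (κ : Fin d), ‖extF N ((Dop f : skewForms d n N) : Form d n N) y κ‖ ≤ AE * g)
    (hcol : d * (L : ℝ) ^ (d - 1) * Ssum d L (j + 1) x ≤ 1 / 2) {K : ℝ}
    (hKdef : K = A₁ + A₁ * (2 * (Fintype.card n : ℝ) * (((L : ℝ) ^ d)⁻¹ * L) ^ (j + 1)) * AE * (2 * (L : ℝ) ^ (j + 1)) * A₀) :
    ∀ h : skewForms d n (N * L ^ (j + 1)), ∀ g : ℝ, (∀ (y : Site d) (κ : Fin d), ‖extF (N * L ^ (j + 1)) (h : Form d n (N * L ^ (j + 1))) y κ‖ ≤ g) →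
      ∀ (z : Site d) (μ' ν' : Fin d), μ' ≠ ν' →
        ‖curlAt W (extF (N * L ^ (j + 1)) ((C h : skewForms d n (N * L ^ (j + 1))) : Form d n (N * L ^ (j + 1)))) z μ' ν'‖ ≤ K * g := by
  intro h g hh z μ' ν' hne
  subst hGdef hDdef
  rw [hKdef, hCdef]
  exact curlRow_constrainedGreen _ _ _ _ hG0
    (fun b g' hb y' κ' => qbarOpK_supRow (N := N) (one_le_two.trans hL) hL j hWu hWP hx hs hWx b g' hb y' κ')
    (fun m' g' hm y' κ' => adjoint_qbarOpK_supRow_class (N := N) (one_le_two.trans hL) j hWu hWP hx hs hWx hcol m' g' hm y' κ') hE W hG1 h hh z μ' ν' hne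

end Split

/-! ## §2 The END with print-shaped rows -/

set_option maxHeartbeats 800000 in
-- the END's statement elaborates at ≈ 200k heartbeats; budget set explicitly, proof is one application of F227
/-- **THE CURVED (APE) ON THE CLASS, RESTING ON PRINT-SHAPED ROWS OF `G_a(W)` AND `(Q̄G_aQ̄†)⁻¹` + THE BOOTSTRAP LINE + NUMERIC LINES.** [folklore] -/
theorem smallField_of_tanCritical_roadB_splitRows_end [Nonempty n] (hd : 2 ≤ d) {L N : ℕ} [NeZero N] (hL : 2 ≤ L) (j : ℕ)
    -- the background
    {W : Site d → Fin d → (Matrix n n ℂ)ˣ} {x : ℝ} (hWu : IsUnitaryCfg W) (hWP : IsPeriodicCfg W ((N * L ^ (j + 1) : ℕ) : ℤ))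
    (hx : 0 ≤ x) (hs : LevelSmall d L j x) (hWx : SmallField W x)
    -- the sup radius of the representative and the regime at `x′ = x + 4(e^{α₀} − 1)`
    {α₀ : ℝ} (hα0 : 0 ≤ α₀) (hs' : LevelSmall d L j (x + 4 * (Real.exp α₀ - 1)))
    (hθ : cruxC d L * (((L : ℝ) ^ (j + 1)) ^ 2 * (x + 4 * (Real.exp α₀ - 1))) < 1)
    (hθl : thetaLoc d L * (((L : ℝ) ^ (j + 1)) ^ 2 * (x + 4 * (Real.exp α₀ - 1))) < 1)
    (hε : ((L : ℝ) ^ (j + 1)) ^ 2 * (x + 4 * (Real.exp α₀ - 1)) ≤ 1)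
    -- the field: of the class, tangent-critical, over `W`'s datum
    {U : Site d → Fin d → (Matrix n n ℂ)ˣ} (hUu : IsUnitaryCfg U) (hUP : IsPeriodicCfg U ((N * L ^ (j + 1) : ℕ) : ℤ))
    {xU : ℝ} (hxU : 0 ≤ xU) (hsU : LevelSmall d L j xU) (hUxU : SmallField U xU)
    (hcritU : ∀ Y : Site d → Fin d → Matrix n n ℂ, IsSkewDir Y → IsPeriodicDir Y ((N * L ^ (j + 1) : ℕ) : ℤ) →
      dirIter L (j + 1) U Y = 0 → dAction U Y (perWin d (N * L ^ (j + 1))) = 0)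
    (hTopUW : cavgIter L (j + 1) U = cavgIter L (j + 1) W)
    -- row NE3's class data of `W` and E′'s initial gauge ∕ regime (as in `exists_landauRep_W`), the constant `c_RE` named; road (B)'s two extra regime lines
    -- the FLUX-GRADIENT radii of `W` and `U` (row NE3's `RegularSup` datum; (1.8)∕(1.9) TYPE via `NE3FluxGradientDictionary` ∕ `MinimalActionClassSix`)
    {gW gU : ℝ} (hgW : ∀ (z : Site d) (μ : Fin d) (π : T4AveragingDeficitWall.Plane d), ‖T4AveragingDeficitWall.covGrad W (T4AveragingDeficitWall.flux W) z μ π‖ ≤ gW)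
    (hgU : ∀ (z : Site d) (μ : Fin d) (π : T4AveragingDeficitWall.Plane d), ‖T4AveragingDeficitWall.covGrad U (T4AveragingDeficitWall.flux U) z μ π‖ ≤ gU)
    (hbx : 23040 * (d : ℝ) ^ 4 * (frameC d L + d) ^ 2 * ((L : ℝ) ^ (j + 1)) ^ 2 * x ≤ 1)
    (hcx : 11520 * (d : ℝ) ^ 4 * (frameC d L + d) ^ 3 * ((L : ℝ) ^ (j + 1)) ^ 3 * (2 * gW) ≤ 1)
    (hbx' : 256 * (d : ℝ) ^ 2 * ((L : ℝ) ^ (j + 1)) ^ 2 * x ≤ 1) (hcx' : 16 * (d : ℝ) * ((L : ℝ) ^ (j + 1)) ^ 3 * (2 * gW) ≤ 1)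
    {r₀ b₀ : ℝ} (hr₀ : ∀ (y : Site d) (μ : Fin d), ‖(((W y μ)⁻¹ * U y μ : (Matrix n n ℂ)ˣ) : (Matrix n n ℂ)) - 1‖ ≤ r₀)
    (hb₀ : ∀ x : Site d, ‖covDiv W (fun y μ => mlog (((W y μ)⁻¹ * U y μ : (Matrix n n ℂ)ˣ) : (Matrix n n ℂ))) x‖ ≤ b₀)
    {cRE : ℝ} (hcRE : cRE = 1 + 2 * (Fintype.card n : ℝ) * (64 * (d : ℝ) ^ 2 * N) ^ d + 27 * (Fintype.card n : ℝ) ^ 3 * (512 : ℝ) ^ d * (N : ℝ) ^ d)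
    (hreg₁ : (36 * (d : ℝ) * (frameC d L + d) ^ 2) * ((L : ℝ) ^ (j + 1)) ^ 2 * (cRE * b₀) ≤ 1 / 10)
    (hreg₂ : (36 * (d : ℝ) * (frameC d L + d)) * (L : ℝ) ^ (j + 1) * (cRE * b₀) ≤ 1 / 25)
    (hreg₃ : r₀ + 5 / 2 * ((36 * (d : ℝ) * (frameC d L + d)) * (L : ℝ) ^ (j + 1) * (cRE * b₀)) ≤ 1 / 20)
    (hline : cRE * (4 * ((36 * (d : ℝ) * (frameC d L + d) ^ 2) * ((L : ℝ) ^ (j + 1)) ^ 2) * (b₀ + 4 * (cRE * b₀))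
        + 25 * d * (r₀ + 5 / 2 * ((36 * (d : ℝ) * (frameC d L + d)) * (L : ℝ) ^ (j + 1) * (cRE * b₀))) * ((36 * (d : ℝ) * (frameC d L + d)) * (L : ℝ) ^ (j + 1))
        + 14 * d * ((36 * (d : ℝ) * (frameC d L + d)) * (L : ℝ) ^ (j + 1)) ^ 2 * (cRE * b₀)) ≤ 1 / 2)
    -- E′'s radii named: `α_E`, `θ_u`; the tent extension's `δ = corrC∕M·2θ_u`; road (B)'s regime `α_E ≤ 1∕40`, `θ_u ≤ 1∕160`, `δ ≤ 1∕40`, `α₀ ≥ α_E + δ + 4(2θ_u+δ)(α_E+δ)`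
    {αE θu : ℝ} (hαE : αE = 2 * (r₀ + 5 / 2 * ((36 * (d : ℝ) * (frameC d L + d)) * (L : ℝ) ^ (j + 1) * (cRE * b₀))))
    (hθu : θu = 4 * ((36 * (d : ℝ) * (frameC d L + d) ^ 2) * ((L : ℝ) ^ (j + 1)) ^ 2 * (cRE * b₀)))
    (hαE40 : αE ≤ 1 / 40) (hθu160 : θu ≤ 1 / 160)
    {δ : ℝ} (hδ : δ = corrC d / (L : ℝ) ^ (j + 1) * (2 * θu)) (hδ40 : δ ≤ 1 / 40) (hα₀ : αE + δ + 4 * (2 * θu + δ) * (αE + δ) ≤ α₀)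
    -- the remaining analytic letters at `W`: (L1)′ and α₁ for the SAME-TOP structured fields of radius `α₀`, (L2), (L3) discharged
    -- (L1)′ DISCHARGED (F111): the quadratic-remainder regime, the slice `S` containing the `W`-tangent skew periodic fields, and the names `c_N = 4m`, `ν = 24·#Plane·m`
    (hs1 : LevelSmall d L (j + 1) x) (hA : curvSum d L (j + 1) x ≤ 2 / 3 * L) (hσ0 : 4 * (3 + 12 * (d : ℝ)) ^ 2 * (L : ℝ) ^ (j + 1) * α₀ ≤ rho0 d L ^ 2)
    {cN aN ν : ℝ}
    (haN : aN = (supC d L / ((L : ℝ) ^ (j + 1) * (1 - cruxC d L * (((L : ℝ) ^ (j + 1)) ^ 2 * x)))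
        * (4 * (3 + 12 * (d : ℝ)) ^ 3 / rho0 d L ^ 2 * ((L : ℝ) ^ (j + 1) * α₀) ^ 2)))
    (hcN : cN = 4 * (supC d L / ((L : ℝ) ^ (j + 1) * (1 - cruxC d L * (((L : ℝ) ^ (j + 1)) ^ 2 * x)))
        * (4 * (3 + 12 * (d : ℝ)) ^ 3 / rho0 d L ^ 2 * ((L : ℝ) ^ (j + 1) * α₀) ^ 2)))
    (hνm : ν = 24 * (Fintype.card (T4AveragingDeficitWall.Plane d) : ℝ) * (supC d L / ((L : ℝ) ^ (j + 1) * (1 - cruxC d L * (((L : ℝ) ^ (j + 1)) ^ 2 * x)))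
        * (4 * (3 + 12 * (d : ℝ)) ^ 3 / rho0 d L ^ 2 * ((L : ℝ) ^ (j + 1) * α₀) ^ 2)))
    -- `x ≤ 1/4` (F141's regime; implied by `hbx'` when `d ≥ 2`, kept displayed for a one-line discharge)
    (hx4 : x ≤ 1 / 4)
    -- ONE MORE displayed regime line at `x` itself (implied by `hθ` at `x′ ≥ x`; kept displayed for a one-line discharge): the surjectivity of `Qbar` (row NE3's right inverse)
    [hPfine : NeZero (N * L ^ (j + 1))]
    (hθx : cruxC d L * (((L : ℝ) ^ (j + 1)) ^ 2 * x) < 1)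
    -- print's mass coefficient `a` ([B9] (3.26) «a(L^jη)^{−2}Q*Q»; in the tree's unweighted unit-lattice sums print's choice reads `a·M^{d−4}`, F202) — a PARAMETER
    (a : ℝ)
    -- TWO MORE displayed regime lines at `x`: row NE3's right-inverse ℓ²-letter (lift piece F214) and its gauge Poincaré regime (F213)
    (hθlx : thetaLoc d L * (((L : ℝ) ^ (j + 1)) ^ 2 * x) < 1)
    (hsmallG : 8 * d * (((L : ℝ) ^ (j + 1)) * (((d : ℝ) - 1) * (((L : ℝ) ^ (j + 1)) - 1) * x)) ^ 2
      + 2 * (Fintype.card n * (4 * (d : ℝ) ^ 2 * ((L : ℝ) ^ (j + 1) - 1) ^ 2 * x + 16 * d * loopRad d L ((prop1Radius d L)^[j] x)) ^ 2) ≤ 1 / 2)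
    -- ROW NE3-R2's CLASS DATA ((P♮)_W is row NE3's THEOREM on `sfClass d L N ε (j+1)`, `NE3ClassRadiusFamily.classSlicePoincare_of_lines'`): `3 ≤ d`, class radius `0 < ε ≤ θ`,
    -- K1 cut `εc > 0`, the two ε-lines and the four k-free numeric lines of row NE3-R2; the orbit comparison's fifth k-free line (F225); and `x` IS the class radius at level `j+1`
    (hd3 : 3 ≤ d) {ε θ εc : ℝ} (hεpos : 0 < ε) (hεθ : ε ≤ θ) (hεc : 0 < εc)
    (hε1 : 16 * (14464 * ((d : ℝ) + 1) ^ 2 * ((d : ℝ) + 4) ^ 2) * ε ≤ 3)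
    (hε2 : 2 * twoLevelSmall d L * ε ≤ (L : ℝ) ^ 2)
    (hK1 : ShLine d L (Fintype.card n) εc θ ≤ 1 / 2) (hK2 : SmallYLine d L (Fintype.card n) εc θ ≤ 1 / 2)
    (hK3 : 68 / 3 * (((d : ℝ) + 1) * ((d : ℝ) + 4)) * C2sq d L * θ ≤ rho d L / 2)
    (hK4 : 8 * d * (((d : ℝ) - 1) * θ) ^ 2
      + 2 * ((Fintype.card n : ℝ) * ((4 * (d : ℝ) ^ 2 + 272 * d * (((d : ℝ) + 1) * ((d : ℝ) + 4))) * θ) ^ 2) ≤ 1 / 2)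
    (hK5 : 32 * (Fintype.card n : ℝ) ^ 2 * (Fintype.card (T4AveragingDeficitWall.Plane d)) * ε ^ 2
      * (2 + 2 * (1 + 4 * ((Fintype.card n : ℝ) * d * (2 + 2 * (((d : ℝ) - 1) * ε)) ^ 2 * (2 * (64 : ℝ) ^ d) ^ 2))) * CPLine d L (Fintype.card n) εc θ ≤ 1 / 2)
    (hxε : x = ε / ((L : ℝ) ^ (j + 1)) ^ 2)
    -- the constant of (H1) NAMED: `C_T = 4·n·(1 + 4C_div²)·CPLine·M²` (k-uniform × M² at `x = ε∕M²`, F225 `cdivSq_le`)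
    {CT : ℝ} (hCTdef : CT = (4 * (Fintype.card n : ℝ) * (1 + 4 * ((Fintype.card n : ℝ) * d * (2 + 2 * (((d : ℝ) - 1) * (((L : ℝ) ^ (j + 1)) - 1) * x) * (L : ℝ) ^ (j + 1)) ^ 2 * (2 / tentMean2 d (L ^ (j + 1))) ^ 2)) * (CPLine d L (Fintype.card n) εc θ) * ((L : ℝ) ^ (j + 1)) ^ 2))
    -- F212's Gårding regime for the mass `a` and the plaquette radius `x` (the class line `x·M²` small, constants of F215–F217)
    (hregP1 : 28 * d * x * (9 * CT * (Fintype.card n : ℝ) + 2 * (4 * Fintype.card n * ((L : ℝ) ^ (j + 1)) ^ 2) * (9 * CT * (16 * Fintype.card n * (Fintype.card (T4AveragingDeficitWall.Plane d)) * x ^ 2 * ((L : ℝ) ^ (j + 1)) ^ 2) + 3)) < 1)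
    (hregP2 : 28 * d * x * ((2 * (4 * Fintype.card n * ((L : ℝ) ^ (j + 1)) ^ 2) * (4 * (d : ℝ)) * (9 * CT * (16 * Fintype.card n * (Fintype.card (T4AveragingDeficitWall.Plane d)) * x ^ 2 * ((L : ℝ) ^ (j + 1)) ^ 2) + 3) + 144 * (d : ℝ) * CT + 3) * (Fintype.card n * ((liftC d / (1 - thetaLoc d L * (((L : ℝ) ^ (j + 1)) ^ 2 * x))) ^ 2 * (((L : ℝ) ^ (j + 1)) ^ d / ((L : ℝ) ^ (j + 1)) ^ 2)))) < a)
    -- Bałaban's constrained propagator `C_a(W) = G_a − G_aQb*(QbG_aQb*)⁻¹QbG_a` (F202's `cGreenSymKa`, a NAMED operator under (P_a), here supplied by F217 ∘ F223 from row NE3's (P♮)_W), named by a defining equation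
    {C : skewForms d n (N * L ^ (j + 1)) →ₗ[ℝ] skewForms d n (N * L ^ (j + 1))}
    (hCdef : C = cGreenSymKa (N := N) (one_le_two.trans hL) j hWu hx hs hWx hWP hL hθx a
      (softSymOpKa_posDef_of_slicePoincare (N := N) (one_le_two.trans hL) hL j hWu hWP hx hs hWx hθx hθlx (le_trans one_le_two hd) hx hWx hsmallG
        (CT_nonneg (d := d) (n := n) j x (CPLine_nonneg (L := L) (le_trans (by norm_num) hd3) (Nat.cast_nonneg (Fintype.card n)) hεc.le (hεpos.le.trans hεθ)) hCTdef)
        (H1_of_frameFree (N := N) hd hL j hWu hWP hx hs hWx hsmallG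
          (CPLine_nonneg (L := L) (le_trans (by norm_num) hd3) (Nat.cast_nonneg (Fintype.card n)) hεc.le (hεpos.le.trans hεθ))
          (classSlicePoincare_of_lines' hd3 hL (Nat.one_le_iff_ne_zero.mpr (NeZero.ne N)) hεpos hεθ hεc hε1 hε2 hK1 hK2 hK3 hK4 j W ⟨hWu, hWP, hxε ▸ hWx⟩)
          (regTA_class (d := d) (n := n) hd3 hL j hεpos hεθ hεc hK5 hxε) hCTdef) hregP1 hregP2))
    -- [B9] Thm 3.3 (3.42)₁,₂ SHAPE for `G_a(W) = softSymOpKa⁻¹` (sup-VALUE row `A₀`, sup-CURL row `A₁`) and (3.49) SHAPE for `(Q̄_W G_a Q̄_W†)⁻¹` (sup row `A_E`) — DISPLAYED, NOT proved;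
    -- the two operators NAMED by defining equations (F202's `softSymGreenKa`, `softSymDinvKa` under the class (P_a) term)
    {Gop : skewForms d n (N * L ^ (j + 1)) →ₗ[ℝ] skewForms d n (N * L ^ (j + 1))}
    (hGdef : Gop = softSymGreenKa (N := N) (one_le_two.trans hL) j hWu hx hs hWx a
      (softSymOpKa_posDef_of_slicePoincare (N := N) (one_le_two.trans hL) hL j hWu hWP hx hs hWx hθx hθlx (le_trans one_le_two hd) hx hWx hsmallG
        (CT_nonneg (d := d) (n := n) j x (CPLine_nonneg (L := L) (le_trans (by norm_num) hd3) (Nat.cast_nonneg (Fintype.card n)) hεc.le (hεpos.le.trans hεθ)) hCTdef)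
        (H1_of_frameFree (N := N) hd hL j hWu hWP hx hs hWx hsmallG
          (CPLine_nonneg (L := L) (le_trans (by norm_num) hd3) (Nat.cast_nonneg (Fintype.card n)) hεc.le (hεpos.le.trans hεθ))
          (classSlicePoincare_of_lines' hd3 hL (Nat.one_le_iff_ne_zero.mpr (NeZero.ne N)) hεpos hεθ hεc hε1 hε2 hK1 hK2 hK3 hK4 j W ⟨hWu, hWP, hxε ▸ hWx⟩)
          (regTA_class (d := d) (n := n) hd3 hL j hεpos hεθ hεc hK5 hxε) hCTdef) hregP1 hregP2))
    {Dop : skewForms d n N →ₗ[ℝ] skewForms d n N}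
    (hDdef : Dop = softSymDinvKa (N := N) (one_le_two.trans hL) j hWu hx hs hWx hWP hL hθx a
      (softSymOpKa_posDef_of_slicePoincare (N := N) (one_le_two.trans hL) hL j hWu hWP hx hs hWx hθx hθlx (le_trans one_le_two hd) hx hWx hsmallG
        (CT_nonneg (d := d) (n := n) j x (CPLine_nonneg (L := L) (le_trans (by norm_num) hd3) (Nat.cast_nonneg (Fintype.card n)) hεc.le (hεpos.le.trans hεθ)) hCTdef)
        (H1_of_frameFree (N := N) hd hL j hWu hWP hx hs hWx hsmallG
          (CPLine_nonneg (L := L) (le_trans (by norm_num) hd3) (Nat.cast_nonneg (Fintype.card n)) hεc.le (hεpos.le.trans hεθ))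
          (classSlicePoincare_of_lines' hd3 hL (Nat.one_le_iff_ne_zero.mpr (NeZero.ne N)) hεpos hεθ hεc hε1 hε2 hK1 hK2 hK3 hK4 j W ⟨hWu, hWP, hxε ▸ hWx⟩)
          (regTA_class (d := d) (n := n) hd3 hL j hεpos hεθ hεc hK5 hxε) hCTdef) hregP1 hregP2))
    {A₀ A₁ AE : ℝ}
    (hG0 : ∀ h : skewForms d n (N * L ^ (j + 1)), ∀ g : ℝ, (∀ (y : Site d) (κ : Fin d), ‖extF (N * L ^ (j + 1)) (h : Form d n (N * L ^ (j + 1))) y κ‖ ≤ g) →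
      ∀ (y : Site d) (κ : Fin d), ‖extF (N * L ^ (j + 1)) ((Gop h : skewForms d n (N * L ^ (j + 1))) : Form d n (N * L ^ (j + 1))) y κ‖ ≤ A₀ * g)
    (hG1 : ∀ h : skewForms d n (N * L ^ (j + 1)), ∀ g : ℝ, (∀ (y : Site d) (κ : Fin d), ‖extF (N * L ^ (j + 1)) (h : Form d n (N * L ^ (j + 1))) y κ‖ ≤ g) →
      ∀ (z : Site d) (μ' ν' : Fin d), μ' ≠ ν' → ‖curlAt W (extF (N * L ^ (j + 1)) ((Gop h : skewForms d n (N * L ^ (j + 1))) : Form d n (N * L ^ (j + 1)))) z μ' ν'‖ ≤ A₁ * g)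
    (hE : ∀ f : skewForms d n N, ∀ g : ℝ, (∀ (y : Site d) (κ : Fin d), ‖extF N (f : Form d n N) y κ‖ ≤ g) →
      ∀ (y : Site d) (κ : Fin d), ‖extF N ((Dop f : skewForms d n N) : Form d n N) y κ‖ ≤ AE * g)
    -- the column line of F228∕F229 for `c_Q* = 2·card n·((L^d)⁻¹L)^{j+1} = 2·card n·M^{1−d}` (`c_Q = 2M` by F205)
    (hcol : d * (L : ℝ) ^ (d - 1) * Ssum d L (j + 1) x ≤ 1 / 2)
    -- the END's rows (C) NAMED from print's rows (F200): `K₀ = A₀(1 + c_Q*·A_E·c_Q·A₀)`, `K = A₁(1 + c_Q*·A_E·c_Q·A₀)`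
    {K₀ K : ℝ} (hK : 0 ≤ K)
    (hK0def : K₀ = A₀ + A₀ * (2 * (Fintype.card n : ℝ) * (((L : ℝ) ^ d)⁻¹ * L) ^ (j + 1)) * AE * (2 * (L : ℝ) ^ (j + 1)) * A₀)
    (hKdef : K = A₁ + A₁ * (2 * (Fintype.card n : ℝ) * (((L : ℝ) ^ d)⁻¹ * L) ^ (j + 1)) * AE * (2 * (L : ℝ) ^ (j + 1)) * A₀)
    -- the bootstrap's class-smallness: `2·card n·τ_W·K₀ ≤ 1` with the DISCHARGED tension radius `τ_W = d·g_W + 12·#Plane·x²` (`NE7TensionRadiusOfFluxGradient`)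
    (hsmall : 2 * (Fintype.card n * ((d : ℝ) * gW + 12 * (Fintype.card (T4AveragingDeficitWall.Plane d) : ℝ) * x ^ 2)) * K₀ ≤ 1)
    -- the END's constant `K_B` NAMED: `K_B = card n · 2K`
    {KB : ℝ} (hKB : KB = Fintype.card n * (2 * K))
    -- (T1♯)'s constants NAMED (F187): `C_a = 2·64^d`, `C_a′ = K_Δ(2g_W)·2·64^d`
    {Ca Ca' : ℝ} (hCa : Ca = 2 * (64 : ℝ) ^ d)
    (hCa' : Ca' = ((35 * (d : ℝ) / ((L : ℝ) ^ (j + 1)) ^ 2 + 2 * (2 * (d : ℝ) ^ 2 * ((L : ℝ) ^ (j + 1) - 1) * (2 * gW) + 8 * (d : ℝ) ^ 3 * ((L : ℝ) ^ (j + 1) - 1) ^ 2 * x ^ 2) + 4 * (d : ℝ) * (((d : ℝ) - 1) * ((L : ℝ) ^ (j + 1) - 1) * x) ^ 2 + 8 * (d : ℝ) * (((d : ℝ) - 1) * ((L : ℝ) ^ (j + 1) - 1) * x) / (L : ℝ) ^ (j + 1)) * (2 * (64 : ℝ) ^ d)))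
    (hcritW : ∀ Y : Site d → Fin d → Matrix n n ℂ, IsSkewDir Y → IsPeriodicDir Y ((N * L ^ (j + 1) : ℕ) : ℤ) → dirIter L (j + 1) W Y = 0 →
      dAction W Y (perWin d (N * L ^ (j + 1))) = 0) :
    SmallField U (x + ((KB * (1 + 2 * d * (2 * ((d : ℝ) * L) * Real.exp (((L : ℝ) ^ d / L) * ((d : ℝ) * (16 * ((d : ℝ) + 1) * ((d : ℝ) + 4) * (L : ℝ) ^ 2) * (1250 * ((nbRad d L : ℝ) + L) + 8 * ((d : ℝ) * L) + 2 * L)) * (2 / twoLevelSmall d L))))) * (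
        ((x + 4 * (Real.exp α₀ - 1))
            * ((curl1C d L / (1 - thetaLoc d L * (((L : ℝ) ^ (j + 1)) ^ 2 * (x + 4 * (Real.exp α₀ - 1)))))
                * (((L : ℝ) ^ (j + 1)) ^ d / ((L : ℝ) ^ (j + 1)) ^ 2))
            * (Real.exp (((L : ℝ) ^ d / L) * ((d : ℝ) * (16 * ((d : ℝ) + 1) * ((d : ℝ) + 4) * (L : ℝ) ^ 2)
                  * (1250 * ((nbRad d L : ℝ) + L) + 8 * ((d : ℝ) * L) + 2 * L)) * (2 / twoLevelSmall d L))
                * ((L : ℝ) / (L : ℝ) ^ d) ^ j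
                * (((d : ℝ) * (2 * nbRad d L + 1) ^ d) * ((2 * (d : ℝ) + 4) * (L : ℝ) ^ 2) * (2 * (L : ℝ) ^ j) * (Real.exp α₀ - 1)
                  + (17 / 8 * ((L : ℝ) ^ 2) ^ j * (x + 4 * (Real.exp α₀ - 1)))
                    * (((d : ℝ) * (2 * nbRad d L + 1) ^ d) * ((2 * (d : ℝ) + 4)
                          * (2 * (2 * L * (nbRad d L : ℝ) + 128 * ((d : ℝ) + 1) * ((d : ℝ) + 4) * (L : ℝ) ^ 2)))
                      + ((d : ℝ) * (2 * nbRad d L + 1) ^ d) * ((2 * (d : ℝ) + 4) * (L : ℝ) ^ 2 * (2 * (nbRad d L : ℝ))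
                          + 2 * (8 * (L : ℝ) + (1250 * ((nbRad d L : ℝ) + L) + 8 * (d * L) + 2 * L))
                              * (16 * ((d : ℝ) + 1) * ((d : ℝ) + 4) * (L : ℝ) ^ 2))))))
        + (Fintype.card (T4AveragingDeficitWall.Plane d) : ℝ)
          * (2 * (240 * (Real.exp α₀ - 1) * α₀ * (2 * ((4 * ((d : ℝ) * αE / ((L ^ (j + 1) : ℕ) : ℝ) + ((L ^ (j + 1) : ℕ) : ℝ) * ((((d : ℝ) - 1) * (2 * gU) + ((d : ℝ) - 1) * (2 * gW) + d * (2 * (Real.exp αE - 1) * xU + 2 * (xU * x) + 2 * (x * (2 + x) * x) + 2 * (xU * (2 + xU) * xU))) + 2 * (b₀ + 3 * (cRE * b₀)))) + (4 * ((L ^ (j + 1) : ℕ) : ℝ) * (8 * d * (Real.exp (4 * αE) - 1) * x + 10 * d * x + 2 * (2 * (d : ℝ) ^ 2 * (((L ^ (j + 1) : ℕ) : ℝ) + 1) * (2 * gW) + 8 * (d : ℝ) ^ 3 * (((L ^ (j + 1) : ℕ) : ℝ) + 1) ^ 2 * x ^ 2) + 12 * d * (2 * (d : ℝ) * (((L ^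 (j + 1) : ℕ) : ℝ) + 1) * x) ^ 2) + 4 * (2 * (d : ℝ) * (((L ^ (j + 1) : ℕ) : ℝ) + 1) * x)) * αE + 2 * x * αE) + 2 * δ + 2 * (4 * (2 * θu + δ) * (αE + δ))) + 24 * α₀ * (Real.exp α₀ - 1) + x) + 8 * α₀ * (2 * ((4 * ((d : ℝ) * αE / ((L ^ (j + 1) : ℕ) : ℝ) + ((L ^ (j + 1) : ℕ) : ℝ) * ((((d : ℝ) - 1) * (2 * gU) + ((d : ℝ) - 1) * (2 * gW) + d * (2 * (Real.exp αE - 1) * xU + 2 * (xU * x) + 2 * (x * (2 + x) * x) + 2 * (xU * (2 + xU) * xU))) + 2 * (b₀ + 3 * (cRE * b₀)))) + (4 * ((L ^ (j + 1) : ℕ) : ℝ) * (8 * d * (Real.exp (4 * αE) - 1) * x + 10 * d * x + 2 * (2 * (d : ℝ) ^ 2 * (((L ^ (j + 1) : ℕ) : ℝ) + 1) * (2 * gW) + 8 * (d : ℝ) ^ 3 * (((L ^ (j + 1) : ℕ) : ℝ) + 1) ^ 2 * x ^ 2) + 12 * d * (2 * (d : ℝ) * (((L ^ (j + 1) : ℕ)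 : ℝ) + 1) * x) ^ 2) + 4 * (2 * (d : ℝ) * (((L ^ (j + 1) : ℕ) : ℝ) + 1) * x)) * αE + 2 * x * αE) + 2 * δ + 2 * (4 * (2 * θu + δ) * (αE + δ))) + 24 * α₀ * (Real.exp α₀ - 1))
              + 6 * (Real.exp α₀ - 1) * (2 * ((4 * ((d : ℝ) * αE / ((L ^ (j + 1) : ℕ) : ℝ) + ((L ^ (j + 1) : ℕ) : ℝ) * ((((d : ℝ) - 1) * (2 * gU) + ((d : ℝ) - 1) * (2 * gW) + d * (2 * (Real.exp αE - 1) * xU + 2 * (xU * x) + 2 * (x * (2 + x) * x) + 2 * (xU * (2 + xU) * xU))) + 2 * (b₀ + 3 * (cRE * b₀)))) + (4 * ((L ^ (j + 1) : ℕ) : ℝ) * (8 * d * (Real.exp (4 * αE) - 1) * x + 10 * d * x + 2 * (2 * (d : ℝ) ^ 2 * (((L ^ (j + 1) : ℕ) : ℝ) + 1) * (2 * gW) + 8 * (d : ℝ) ^ 3 * (((L ^ (j + 1) : ℕ) : ℝ) + 1) ^ 2 * x ^ 2) + 12 * d * (2 * (d : ℝ) * (((L ^ (j + 1) : ℕ)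 : ℝ) + 1) * x) ^ 2) + 4 * (2 * (d : ℝ) * (((L ^ (j + 1) : ℕ) : ℝ) + 1) * x)) * αE + 2 * x * αE) + 2 * δ + 2 * (4 * (2 * θu + δ) * (αE + δ))) + 24 * (Real.exp α₀ - 1) * α₀)
              + (2 * ((4 * ((d : ℝ) * αE / ((L ^ (j + 1) : ℕ) : ℝ) + ((L ^ (j + 1) : ℕ) : ℝ) * ((((d : ℝ) - 1) * (2 * gU) + ((d : ℝ) - 1) * (2 * gW) + d * (2 * (Real.exp αE - 1) * xU + 2 * (xU * x) + 2 * (x * (2 + x) * x) + 2 * (xU * (2 + xU) * xU))) + 2 * (b₀ + 3 * (cRE * b₀)))) + (4 * ((L ^ (j + 1) : ℕ) : ℝ) * (8 * d * (Real.exp (4 * αE) - 1) * x + 10 * d * x + 2 * (2 * (d : ℝ) ^ 2 * (((L ^ (j + 1) : ℕ) : ℝ) + 1) * (2 * gW) + 8 * (d : ℝ) ^ 3 * (((L ^ (j + 1) : ℕ) : ℝ) + 1) ^ 2 * x ^ 2) + 12 * d * (2 * (d : ℝ) * (((L ^ (j + 1) : ℕ) : ℝ) + 1) * x) ^ 2)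 + 4 * (2 * (d : ℝ) * (((L ^ (j + 1) : ℕ) : ℝ) + 1) * x)) * αE + 2 * x * αE) + 2 * δ + 2 * (4 * (2 * θu + δ) * (αE + δ))) + 24 * (Real.exp α₀ - 1) * α₀) * (2 * ((4 * ((d : ℝ) * αE / ((L ^ (j + 1) : ℕ) : ℝ) + ((L ^ (j + 1) : ℕ) : ℝ) * ((((d : ℝ) - 1) * (2 * gU) + ((d : ℝ) - 1) * (2 * gW) + d * (2 * (Real.exp αE - 1) * xU + 2 * (xU * x) + 2 * (x * (2 + x) * x) + 2 * (xU * (2 + xU) * xU))) + 2 * (b₀ + 3 * (cRE * b₀)))) + (4 * ((L ^ (j + 1) : ℕ) : ℝ) * (8 * d * (Real.exp (4 * αE) - 1) * x + 10 * d * x + 2 * (2 * (d : ℝ) ^ 2 * (((L ^ (j + 1) : ℕ) : ℝ) + 1) * (2 * gW) + 8 * (d : ℝ) ^ 3 * (((L ^ (j + 1) : ℕ) : ℝ) + 1) ^ 2 * x ^ 2) + 12 * d * (2 * (d : ℝ) * (((L ^ (j + 1) : ℕ) : ℝ) + 1) * x) ^ 2) + 4 * (2 * (d : ℝ) * (((L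 ^ (j + 1) : ℕ) : ℝ) + 1) * x)) * αE + 2 * x * αE) + 2 * δ + 2 * (4 * (2 * θu + δ) * (αE + δ))) + 24 * α₀ * (Real.exp α₀ - 1))
              + 960 * (Real.exp α₀ - 1) * α₀ ^ 2 + 32 * x * α₀ ^ 2)
            + (64 * α₀ * ((4 * ((d : ℝ) * αE / ((L ^ (j + 1) : ℕ) : ℝ) + ((L ^ (j + 1) : ℕ) : ℝ) * ((((d : ℝ) - 1) * (2 * gU) + ((d : ℝ) - 1) * (2 * gW) + d * (2 * (Real.exp αE - 1) * xU + 2 * (xU * x) + 2 * (x * (2 + x) * x) + 2 * (xU * (2 + xU) * xU))) + 2 * (b₀ + 3 * (cRE * b₀)))) + (4 * ((L ^ (j + 1) : ℕ) : ℝ) * (8 * d * (Real.exp (4 * αE) - 1) * x + 10 * d * x + 2 * (2 * (d : ℝ) ^ 2 * (((L ^ (j + 1) : ℕ) : ℝ) + 1) * (2 * gW) + 8 * (d : ℝ) ^ 3 * (((L ^ (j + 1) : ℕ) : ℝ) + 1) ^ 2 * x ^ 2) + 12 * d * (2 * (d : ℝ) * (((L ^ (j + 1) : ℕ) : ℝ)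 + 1) * x) ^ 2) + 4 * (2 * (d : ℝ) * (((L ^ (j + 1) : ℕ) : ℝ) + 1) * x)) * αE + 2 * x * αE) + 2 * δ + 2 * (4 * (2 * θu + δ) * (αE + δ))) + 1024 * x * α₀ ^ 2))
        + ν) + (2 * d * KB * (2 * ((d : ℝ) * L) * Real.exp (((L : ℝ) ^ d / L) * ((d : ℝ) * (16 * ((d : ℝ) + 1) * ((d : ℝ) + 4) * (L : ℝ) ^ 2) * (1250 * ((nbRad d L : ℝ) + L) + 8 * ((d : ℝ) * L) + 2 * L)) * (2 / twoLevelSmall d L))) * ((d : ℝ) * gW + 12 * (Fintype.card (T4AveragingDeficitWall.Plane d) : ℝ) * x ^ 2)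
              + (2 * KB * ((d : ℝ) * gW + 12 * (Fintype.card (T4AveragingDeficitWall.Plane d) : ℝ) * x ^ 2) * (1 + 4 * d * (2 * ((d : ℝ) * L) * Real.exp (((L : ℝ) ^ d / L) * ((d : ℝ) * (16 * ((d : ℝ) + 1) * ((d : ℝ) + 4) * (L : ℝ) ^ 2) * (1250 * ((nbRad d L : ℝ) + L) + 8 * ((d : ℝ) * L) + 2 * L)) * (2 / twoLevelSmall d L)))) + 2 * x) * ((Ca + (36 * d * (frameC d L + d) ^ 2 * ((L : ℝ) ^ (j + 1)) ^ 2 * cRE) * Ca') * (6 * (d : ℝ) * (L : ℝ) ^ (j + 1)))) * (α₀ + aN)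
        + ((2 * KB * ((d : ℝ) * gW + 12 * (Fintype.card (T4AveragingDeficitWall.Plane d) : ℝ) * x ^ 2) * (1 + 4 * d * (2 * ((d : ℝ) * L) * Real.exp (((L : ℝ) ^ d / L) * ((d : ℝ) * (16 * ((d : ℝ) + 1) * ((d : ℝ) + 4) * (L : ℝ) ^ 2) * (1250 * ((nbRad d L : ℝ) + L) + 8 * ((d : ℝ) * L) + 2 * L)) * (2 / twoLevelSmall d L)))) + 2 * x) * (36 * d * (frameC d L + d) ^ 2 * ((L : ℝ) ^ (j + 1)) ^ 2 * cRE)) * (2 * (d : ℝ) * (4 * (2 * θu + δ) * (αE + δ)) + (b₀ + 3 * (cRE * b₀)) + 2 * (d : ℝ) * aN) 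
        + ((2 * KB * ((d : ℝ) * gW + 12 * (Fintype.card (T4AveragingDeficitWall.Plane d) : ℝ) * x ^ 2) * (1 + 4 * d * (2 * ((d : ℝ) * L) * Real.exp (((L : ℝ) ^ d / L) * ((d : ℝ) * (16 * ((d : ℝ) + 1) * ((d : ℝ) + 4) * (L : ℝ) ^ 2) * (1250 * ((nbRad d L : ℝ) + L) + 8 * ((d : ℝ) * L) + 2 * L)) * (2 / twoLevelSmall d L)))) + 2 * x) * (1 + (Ca + (36 * d * (frameC d L + d) ^ 2 * ((L : ℝ) ^ (j + 1)) ^ 2 * cRE) * Ca'))) * (2 * θu) + cN + 28 * α₀ ^ 2)) :=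
  smallField_of_tanCritical_roadB_class_end hd hL j hWu hWP hx hs hWx hα0 hs' hθ hθl hε hUu hUP hxU hsU hUxU hcritU hTopUW hgW hgU hbx hcx hbx' hcx' hr₀ hb₀ hcRE hreg₁ hreg₂ hreg₃ hline hαE hθu hαE40 hθu160 hδ hδ40 hα₀ hs1 hA hσ0 haN hcN hνm hx4 hθx a hθlx hsmallG hd3 hεpos hεθ hεc hε1 hε2 hK1 hK2 hK3 hK4 hK5 hxε hCTdef hregP1 hregP2 hCdef hK (valueRow_of_split (N := N) hL j hWu hWP hx hs hWx hθx a hCdef hGdef hDdef hG0 hE hcol hK0def) (curlRow_of_split (N := N) hL j hWu hWP hx hs hWx hθx a hCdef hGdef hDdef hG0 hG1 hE hcol hKdef) hsmall hKB hCa hCa' hcritW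

end

end Summit.QuantumFields.BalabanUV.T4Continuum.NE7ApeCurvedRepRoadBSplitRowsEnd
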